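import Summits.QuantumFields.BalabanUV.T4Continuum.Support.AveragingDeficitFaceLift

/-!
# AveragingDeficitLiftPeriodic (T⁴ programme, node NE3, row NE3-R2, gen 2) — THE NON-ABELIAN LIFT ON THE TORUS:
# translation covariance of the differential of (42) (`pushDir L V (ψ(· − t)) (c + t) = pushDir L V ψ (c)` for
# `t`-invariant `V`), hence the face lift of PERIODIC coarse data over a PERIODIC configuration is PERIODIC —
# `exists_lift_periodic`: the lift of `AveragingDeficitFaceLift.exists_lift_of_smallField` with, in addition,
# `IsPeriodicDir ψ (L·M)` (file 3d of the non-abelian lift γ)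

HONEST FRAMING (cell `pub-balaban`, T4-DAG PAGE 1; unit `b2b-balaban-t4-ne3r2-p1` = owner of BINDER-OWNERS row NE3-R2,
gen 2).  The cell's T4 target is the finite-torus continuum limit of the unit-scale averaged loop expectations — NOT
infinite volume, NO mass gap, NOT Clay, NOT summit progress.  The torus consumer of the NE3 energy route needs the
lift γ for PERIODIC directions (the proved periodic wall β-per, `AveragingDeficitDerivWallPeriodic`, and the residual
pairing `AveragingDeficitResidualPairing.residualPairing_torus` quantify over periodic `ψ`).  THIS FILE (all [folklore],
0 sorry): §1 translation covariance — `shiftDir t ψ = ψ(· − t)`; for a configuration invariant under `x ↦ x + t`: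
`hol_shift`, `vary_shift`, `Wcx_vary_shift`, `mlogDeriv_shift`, `XavgDeriv_shift`, `Xavg_shift`, `dhol_shift`,
`sideDeriv_shift`, `bavg_shift`, **`pushDir_shift`**; §2 `bondDir_shift`, `faceSite_add_smul`, **`liftMap_shift`** (the lift
maps of `c` and `c + v` coincide for `L•v`-invariant `V`), `liftMap_injective`; §3 **`exists_lift_periodic`**: for
`U(N)`-valued `V` of period `L·M` with `liftSmall d L · a ≤ 1` and coarse data `φ` of period `M`, the face lift `ψ` of
file 3c can be taken PERIODIC of period `L·M` (bondwise preimages are unique by injectivity, and the lift maps of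
translated bonds coincide), face-supported, `pushDir L V ψ (Ly) κ = φ(y,κ)`, `|ψ(b₀)| ≤ 2L^d|φ|`, `𝔲(N)`-valued if `φ` is.
NE3 ITSELF IS NOT PROVED (energy route: NE3(A) ⇐ ML ∧ R0 ∧ β ∧ γ; (γ2)–(γ4), ML, R0, δ untouched); NE3 stays COND-free.
CITATION HEADER: no printed sentence is a hypothesis; the manuscripts under audit are not cited for any disputed step;
context: T. Bałaban, Commun. Math. Phys. **98** (1985) 17–51 [Balaban1985Averaging] ((9) p. 18, (42) p. 23, (45) p. 24).
PLACEMENT: `Summits/QuantumFields/BalabanUV/` (human rule 2026-08-19).  Record: HOME `t4/T4-EST-NE3-R2.md` v0.3.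
-/

set_option autoImplicit false

open scoped BigOperators Matrix Matrix.Norms.L2Operator Topology
open NormedSpace Finset Filter

namespace Summit.QuantumFields.BalabanUV.T4Continuum.AveragingDeficitLiftPeriodic

open Literature.MathematicalPhysics.QuantumFieldTheory.Balaban1983to89
open B7Prop1Explicit B7Prop2Explicit MatrixLog UnitaryModel
open T4AveragingDeficitWall hiding Site Plane Plaq Bond
open T4AveragingDeficitWallBoundary (IsPeriodicCfg)
open T4AveragingDeficitNonAbelian (Ad_mul Ad_sub)
open AveragingDeficitTransport AveragingDeficitLocality AveragingDeficitNearIdentity AveragingDeficitSideDeriv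
open AveragingDeficitResidualPairing AveragingDeficitTransportCalc AveragingDeficitPushForwardLinear
open AveragingDeficitPeriodicCounting AveragingDeficitFaceWords AveragingDeficitLiftMap AveragingDeficitFaceLift

noncomputable section

variable {d : ℕ} {n : Type*} [Fintype n] [DecidableEq n]

local notation "𝕄" => Matrix n n ℂ
local notation "Site" => B7Prop1Explicit.Site

/-! ## §1 Translation covariance of the differential of (42) -/

/-- The translated direction `ψ(· − t)`. [folklore] -/
def shiftDir (t : Site d) (ψ : Site d → Fin d → 𝕄) : Site d → Fin d → 𝕄 := fun z i => ψ (z - t) i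

omit [Fintype n] [DecidableEq n] in
/-- Value of the translated direction. [folklore] -/
@[simp] theorem shiftDir_apply_add (t : Site d) (ψ : Site d → Fin d → 𝕄) (z : Site d) (i : Fin d) :
    shiftDir t ψ (z + t) i = ψ z i := by simp [shiftDir]

/-- Transport of a translation-related pair of configurations: `W′(x + t, ·) = W(x, ·)` ⇒ `W′(Γ + t) = W(Γ)`.
[cite: Balaban1985Averaging, (9) p.18] -/
theorem hol_shift {W W' : Site d → Fin d → 𝕄ˣ} {t : Site d} (h : ∀ (x : Site d) (μ : Fin d), W' (x + t) μ = W x μ) :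
    ∀ (w : List (Letter d)) (x : Site d), hol W' (x + t) w = hol W x w
  | [], x => by simp
  | l :: w, x => by
    have hstep : stepHol W' (x + t) l = stepHol W x l := by
      unfold stepHol
      split_ifs
      · exact h x l.1
      · rw [add_right_comm, h]
    rw [hol_cons, hol_cons, hstep, add_right_comm, hol_shift h w (x + l.vec)]

/-- The perturbation along the translated direction is the translated perturbation (for `t`-invariant `V`). [folklore] -/
theorem vary_shift {V : Site d → Fin d → 𝕄ˣ} {t : Site d} (hV : ∀ (x : Site d) (μ : Fin d), V (x + t) μ = V x μ)
    (ψ : Site d → Fin d → 𝕄) (s : ℝ) (x : Site d) (μ : Fin d) :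
    vary V (shiftDir t ψ) s (x + t) μ = vary V ψ s x μ := by
  simp only [vary, hV x μ, shiftDir_apply_add]

/-- The loop variables of (42) along the translated perturbation. [cite: Balaban1985Averaging, (42) p.23] -/
theorem Wcx_vary_shift (L : ℕ) {V : Site d → Fin d → 𝕄ˣ} {t : Site d} (hV : ∀ (x : Site d) (μ : Fin d), V (x + t) μ = V x μ)
    (ψ : Site d → Fin d → 𝕄) (s : ℝ) (q : Site d) (κ : Fin d) (r : Site d) :
    Wcx L (vary V (shiftDir t ψ) s) (q + t) κ r = Wcx L (vary V ψ s) q κ r := by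
  rw [Wcx_eq_hol_loop, Wcx_eq_hol_loop]
  exact hol_shift (fun x μ => vary_shift hV ψ s x μ) _ _

/-- `(log W_s)′` is translation covariant. [folklore] -/
theorem mlogDeriv_shift (L : ℕ) {V : Site d → Fin d → 𝕄ˣ} {t : Site d} (hV : ∀ (x : Site d) (μ : Fin d), V (x + t) μ = V x μ)
    (ψ : Site d → Fin d → 𝕄) (q : Site d) (κ : Fin d) (r : Site d) :
    mlogDeriv L V (shiftDir t ψ) (q + t) κ r = mlogDeriv L V ψ q κ r := by
  unfold mlogDeriv
  congr 1
  funext s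
  rw [Wcx_vary_shift L hV]

/-- `X_c′` is translation covariant. [folklore] -/
theorem XavgDeriv_shift (L : ℕ) {V : Site d → Fin d → 𝕄ˣ} {t : Site d} (hV : ∀ (x : Site d) (μ : Fin d), V (x + t) μ = V x μ)
    (ψ : Site d → Fin d → 𝕄) (q : Site d) (κ : Fin d) :
    XavgDeriv L V (shiftDir t ψ) (q + t) κ = XavgDeriv L V ψ q κ := by
  unfold XavgDeriv
  exact Finset.sum_congr rfl fun r _ => by rw [mlogDeriv_shift L hV]

/-- `X_c` is translation invariant. [folklore] -/
theorem Xavg_shift (L : ℕ) {V : Site d → Fin d → 𝕄ˣ} {t : Site d} (hV : ∀ (x : Site d) (μ : Fin d), V (x + t) μ = V x μ)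
    (q : Site d) (κ : Fin d) : Xavg L V (q + t) κ = Xavg L V q κ := by
  unfold Xavg
  refine Finset.sum_congr rfl fun r _ => ?_
  have h := Wcx_vary_shift L hV (0 : Site d → Fin d → 𝕄) 0 q κ (boxVec L r)
  have h0 : shiftDir t (0 : Site d → Fin d → 𝕄) = 0 := by funext z i; rfl
  simp only [h0, vary_zero] at h
  rw [h]

/-- `(δ_ψV)(Γ)` is translation covariant. [folklore] -/
theorem dhol_shift {V : Site d → Fin d → 𝕄ˣ} {t : Site d} (hV : ∀ (x : Site d) (μ : Fin d), V (x + t) μ = V x μ)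
    (ψ : Site d → Fin d → 𝕄) : ∀ (w : List (Letter d)) (x : Site d), dhol V (shiftDir t ψ) (x + t) w = dhol V ψ x w
  | [], x => by simp
  | l :: w, x => by
    have hstep : dstep V (shiftDir t ψ) (x + t) l = dstep V ψ x l := by
      obtain ⟨μ, b⟩ := l
      cases b
      · simp only [dstep, Bool.false_eq_true, ↓reduceIte, add_right_comm x t, shiftDir_apply_add]
      · simp only [dstep, ↓reduceIte, hV x μ, shiftDir_apply_add]
    have hhol : stepHol V (x + t) l = stepHol V x l := by
      unfold stepHol
      split_ifs
      · exact hV x l.1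
      · rw [add_right_comm, hV]
    rw [dhol_cons, dhol_cons, hstep, hhol, add_right_comm, dhol_shift hV ψ w (x + l.vec)]

/-- `δV̄(c)` is translation covariant. [folklore] -/
theorem sideDeriv_shift (L : ℕ) {V : Site d → Fin d → 𝕄ˣ} {t : Site d} (hV : ∀ (x : Site d) (μ : Fin d), V (x + t) μ = V x μ)
    (ψ : Site d → Fin d → 𝕄) (q : Site d) (κ : Fin d) :
    sideDeriv L V (shiftDir t ψ) (q + t) κ = sideDeriv L V ψ q κ := by
  unfold sideDeriv
  rw [Xavg_shift L hV, XavgDeriv_shift L hV, dhol_shift hV]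

/-- The average (42) of a `t`-invariant configuration is `t`-invariant. [cite: Balaban1985Averaging, (42) p.23] -/
theorem bavg_shift (L : ℕ) {V : Site d → Fin d → 𝕄ˣ} {t : Site d} (hV : ∀ (x : Site d) (μ : Fin d), V (x + t) μ = V x μ)
    (q : Site d) (κ : Fin d) : bavg L V (q + t) κ = bavg L V q κ := by
  unfold bavg
  rw [Xavg_shift L hV, hol_shift hV]

/-- **THE DIFFERENTIAL OF (42) IS TRANSLATION COVARIANT**: `pushDir L V (ψ(· − t)) (c + t) = pushDir L V ψ (c)` for
`t`-invariant `V`. [cite: Balaban1985Averaging, (42) p.23] -/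
theorem pushDir_shift (L : ℕ) {V : Site d → Fin d → 𝕄ˣ} {t : Site d} (hV : ∀ (x : Site d) (μ : Fin d), V (x + t) μ = V x μ)
    (ψ : Site d → Fin d → 𝕄) (q : Site d) (κ : Fin d) :
    pushDir L V (shiftDir t ψ) (q + t) κ = pushDir L V ψ q κ := by
  unfold pushDir
  rw [bavg_shift L hV, sideDeriv_shift L hV]

/-! ## §2 The lift maps of translated coarse bonds coincide -/

omit [Fintype n] [DecidableEq n] in
/-- The one-bond direction of a translated bond is the translated one-bond direction. [folklore] -/
theorem bondDir_shift (z₀ t : Site d) (i₀ : Fin d) (m : 𝕄) : bondDir (z₀ + t) i₀ m = shiftDir t (bondDir z₀ i₀ m) := by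
  funext z i
  simp only [bondDir, shiftDir, sub_eq_iff_eq_add]

omit [Fintype n] [DecidableEq n] in
/-- `b₀(c + v) = b₀(c) + Lv`. [folklore] -/
theorem faceSite_add (L : ℕ) (y v : Site d) (κ : Fin d) : faceSite L (y + v) κ = faceSite L y κ + (L : ℤ) • v := by
  simp only [faceSite, smul_add]; abel

/-- Invariance under one period from periodicity in every direction, for period vectors `P•v`. [folklore] -/
theorem invariant_of_periodic {V : Site d → Fin d → 𝕄ˣ} {P : ℤ} (hV : IsPeriodicCfg V P) (j : Fin d) :
    ∀ (x : Site d) (μ : Fin d), V (x + P • e j) μ = V x μ := fun x μ => hV x j μ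

/-- **THE LIFT MAPS OF `c` AND `c + v` COINCIDE** for `L•v`-invariant `V` (values; the loop-bound certificates may
differ). [folklore] -/
theorem liftMap_shift (L : ℕ) {V : Site d → Fin d → 𝕄ˣ} (y v : Site d) (κ : Fin d)
    (hV : ∀ (x : Site d) (μ : Fin d), V (x + (L : ℤ) • v) μ = V x μ) {w : ℝ} (hw : w ≤ 1 / 32)
    (hW : LoopBound L V y κ w) (hW' : LoopBound L V (y + v) κ w) (m : 𝕄) :
    liftMap L V (y + v) κ hw hW' m = liftMap L V y κ hw hW m := by
  rw [liftMap_apply, liftMap_apply, faceSite_add, bondDir_shift, smul_add, pushDir_shift L hV]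

/-- The lift map is injective in the inversion regime. [folklore] -/
theorem liftMap_injective [Nonempty n] {L : ℕ} (hL : 1 ≤ L) {V : Site d → Fin d → 𝕄ˣ} (hV : IsUnitaryCfg V)
    (y : Site d) (κ : Fin d) {w : ℝ} (hw0 : 0 ≤ w) (hwL : 2044 * (L : ℝ) ^ d * w ≤ 1) (hw : w ≤ 1 / 32)
    (hW : LoopBound L V y κ w) : Function.Injective (liftMap L V y κ hw hW) := by
  have hLd : (0 : ℝ) < (L : ℝ) ^ d := pow_pos (by exact_mod_cast hL) d
  intro m m' h
  have h1 := norm_liftMap_ge hL hV y κ hw0 hwL hw hW (m - m')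
  rw [map_sub, h, sub_self, norm_zero] at h1
  have h2 : ‖m - m'‖ ≤ 0 := by
    by_contra hc
    have : 0 < ((L : ℝ) ^ d)⁻¹ / 2 * ‖m - m'‖ := mul_pos (by positivity) (lt_of_not_ge hc)
    linarith
  exact sub_eq_zero.mp (norm_le_zero_iff.mp h2)

/-! ## §3 The periodic lift -/

omit [Fintype n] [DecidableEq n] in
/-- The face lift of PERIODIC coarse data is periodic. [folklore] -/
theorem isPeriodicDir_faceLift {L : ℕ} (hL : 1 ≤ L) {m : Site d → Fin d → 𝕄} {M : ℕ}
    (hm : ∀ (y : Site d) (j κ : Fin d), m (y + (M : ℤ) • e j) κ = m y κ) :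
    IsPeriodicDir (faceLift L m) ((L : ℤ) * M) := by
  intro z j i
  by_cases hf : IsFaceBond L z i
  · obtain ⟨y, rfl⟩ := hf
    have e1 : faceSite L y i + ((L : ℤ) * M) • e j = faceSite L (y + (M : ℤ) • e j) i := by
      rw [faceSite_add, smul_smul]
    rw [e1, faceLift_faceSite hL, faceLift_faceSite hL, hm]
  · have hf' : ¬ IsFaceBond L (z + ((L : ℤ) * M) • e j) i := by
      rintro ⟨y, hy⟩
      refine hf ⟨y - (M : ℤ) • e j, ?_⟩
      rw [show y = (y - (M : ℤ) • e j) + (M : ℤ) • e j by abel, faceSite_add, smul_smul] at hy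
      exact add_right_cancel hy
    rw [faceSupported_faceLift L m _ _ hf, faceSupported_faceLift L m _ _ hf']

/-- **THE PERIODIC LIFT (γ1) ON THE TORUS**: for `U(N)`-valued `V` of period `L·M` (`M ≥ 1`) with loop bound `w`,
`2048·L^d·w ≤ 1`, and coarse data `φ` of period `M`, there is a fine direction `ψ`, face-supported, PERIODIC of period
`L·M`, with `pushDir L V ψ (Ly) κ = φ(y, κ)` for all coarse bonds, `|ψ(b₀(y,κ))| ≤ 2L^d|φ(y,κ)|`, `𝔲(N)`-valued if `φ` is.
[cite: Balaban1985Averaging, (42) p.23, (45) p.24] -/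
theorem exists_lift_periodic' [Nonempty n] {L : ℕ} (hL : 1 ≤ L) {M : ℕ} {V : Site d → Fin d → 𝕄ˣ} (hV : IsUnitaryCfg V)
    (hVP : IsPeriodicCfg V ((L : ℤ) * M)) {w : ℝ} (hw0 : 0 ≤ w) (hwL : 2048 * (L : ℝ) ^ d * w ≤ 1)
    (hW : ∀ (y : Site d) (κ : Fin d), LoopBound L V y κ w) (φ : Site d → Fin d → 𝕄)
    (hφ : ∀ (y : Site d) (j κ : Fin d), φ (y + (M : ℤ) • e j) κ = φ y κ) :
    ∃ ψ : Site d → Fin d → 𝕄, FaceSupported L ψ ∧ IsPeriodicDir ψ ((L : ℤ) * M)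
      ∧ (∀ (y : Site d) (κ : Fin d), pushDir L V ψ ((L : ℤ) • y) κ = φ y κ)
      ∧ (∀ (y : Site d) (κ : Fin d), ‖ψ (faceSite L y κ) κ‖ ≤ 2 * (L : ℝ) ^ d * ‖φ y κ‖)
      ∧ ((∀ (y : Site d) (κ : Fin d), φ y κ ∈ skewAdjoint 𝕄) → IsSkewDir ψ) := by
  have hLd : (1 : ℝ) ≤ (L : ℝ) ^ d := one_le_pow₀ (by exact_mod_cast hL)
  have hw : w ≤ 1 / 32 := by nlinarith
  have hwL' : 2044 * (L : ℝ) ^ d * w ≤ 1 := by nlinarith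
  have key : ∀ (y : Site d) (κ : Fin d), ∃ m : 𝕄, liftMap L V y κ hw (hW y κ) m = φ y κ ∧
      ‖m‖ ≤ 2 * (L : ℝ) ^ d * ‖φ y κ‖ ∧ (φ y κ ∈ skewAdjoint 𝕄 → m ∈ skewAdjoint 𝕄) := by
    intro y κ
    by_cases hφs : φ y κ ∈ skewAdjoint 𝕄
    · obtain ⟨m, hm, h1, h2⟩ := exists_preimage_skew hL hV y κ hw0 hwL' hw (hW y κ) hφs
      exact ⟨m, h1, h2, fun _ => hm⟩
    · obtain ⟨m, h1, h2⟩ := exists_preimage hL hV y κ hw0 hwL' hw (hW y κ) (φ y κ)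
      exact ⟨m, h1, h2, fun h => absurd h hφs⟩
  choose m hm1 hm2 hm3 using key
  -- periodicity of the chosen preimages: uniqueness + covariance
  have hVt : ∀ (j : Fin d) (x : Site d) (μ : Fin d), V (x + (L : ℤ) • ((M : ℤ) • e j)) μ = V x μ := by
    intro j x μ
    rw [smul_smul]
    exact hVP x j μ
  have hmP : ∀ (y : Site d) (j κ : Fin d), m (y + (M : ℤ) • e j) κ = m y κ := by
    intro y j κ
    apply liftMap_injective hL hV (y + (M : ℤ) • e j) κ hw0 hwL' hw (hW _ κ)
    rw [hm1, hφ, liftMap_shift L y ((M : ℤ) • e j) κ (hVt j) hw (hW y κ) (hW _ κ), hm1]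
  refine ⟨faceLift L m, faceSupported_faceLift L m, isPeriodicDir_faceLift hL hmP, fun y κ => ?_, fun y κ => ?_,
    fun hφs => ?_⟩
  · rw [← hm1 y κ, liftMap_apply]
    exact pushDir_congr L V _ κ (fun r b hb => faceLift_agree hL m y κ b (Or.inl ⟨r, hb⟩))
      fun b hb => faceLift_agree hL m y κ b (Or.inr hb)
  · rw [faceLift_faceSite hL]; exact hm2 y κ
  · exact isSkewDir_faceLift L fun y κ => hm3 y κ (hφs y κ)

/-- **THE PERIODIC LIFT IN THE SMALL-FIELD CLASS**: `U(N)`-valued `V` of period `L·M`, `|V(∂p) − 1| ≤ a`,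
`liftSmall d L · a ≤ 1`, coarse data `φ` of period `M` ⇒ a periodic face-supported lift as above.
[cite: Balaban1985Averaging, (42) p.23, (44)–(45) p.24] -/
theorem exists_lift_periodic [Nonempty n] {L : ℕ} (hL : 1 ≤ L) {M : ℕ} {V : Site d → Fin d → 𝕄ˣ}
    (hV : IsUnitaryCfg V) (hVP : IsPeriodicCfg V ((L : ℤ) * M)) {a : ℝ} (ha : 0 ≤ a) (hsmall : liftSmall d L * a ≤ 1)
    (hVa : SmallField V a) (φ : Site d → Fin d → 𝕄) (hφ : ∀ (y : Site d) (j κ : Fin d), φ (y + (M : ℤ) • e j) κ = φ y κ) :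
    ∃ ψ : Site d → Fin d → 𝕄, FaceSupported L ψ ∧ IsPeriodicDir ψ ((L : ℤ) * M)
      ∧ (∀ (y : Site d) (κ : Fin d), pushDir L V ψ ((L : ℤ) • y) κ = φ y κ)
      ∧ (∀ (y : Site d) (κ : Fin d), ‖ψ (faceSite L y κ) κ‖ ≤ 2 * (L : ℝ) ^ d * ‖φ y κ‖)
      ∧ ((∀ (y : Site d) (κ : Fin d), φ y κ ∈ skewAdjoint 𝕄) → IsSkewDir ψ) := by
  have hL1 : (1 : ℝ) ≤ L := by exact_mod_cast hL
  have hLd : (1 : ℝ) ≤ (L : ℝ) ^ d := one_le_pow₀ hL1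
  have hd0 : (0 : ℝ) ≤ d := Nat.cast_nonneg d
  unfold liftSmall at hsmall
  have hpow : (L : ℝ) ^ (d + 2) = (L : ℝ) ^ d * (L : ℝ) ^ 2 := by ring
  rw [hpow] at hsmall
  have h512 : 512 * (d + 1) * (d + 4) * (L : ℝ) ^ 2 * a ≤ 1 := by
    have : 512 * ((d : ℝ) + 1) * ((d : ℝ) + 4) * (L : ℝ) ^ 2 * a
        ≤ 32768 * ((d : ℝ) + 1) * ((d : ℝ) + 4) * ((L : ℝ) ^ d * (L : ℝ) ^ 2) * a := by
      have h0 : 0 ≤ ((d : ℝ) + 1) * ((d : ℝ) + 4) * (L : ℝ) ^ 2 * a := by positivity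
      nlinarith
    linarith
  have hU : ∀ (x : Site d) (κ : Fin d), V x κ ∈ U1 𝕄 := fun x κ => mem_U1_of_unitary (hV x κ)
  set w : ℝ := 2 * (8 * (d + 1) * (d + 4) * (L : ℝ) ^ 2 * a) with hw
  have hW : ∀ (y : Site d) (κ : Fin d), LoopBound L V y κ w := fun y κ r =>
    norm_Wcx_sub_one_le L hL V hU ha h512 hVa _ κ r
  have hw0 : 0 ≤ w := by rw [hw]; positivity
  have hwL : 2048 * (L : ℝ) ^ d * w ≤ 1 := by
    rw [hw]
    have : 2048 * (L : ℝ) ^ d * (2 * (8 * (d + 1) * (d + 4) * (L : ℝ) ^ 2 * a))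
        = 32768 * ((d : ℝ) + 1) * ((d : ℝ) + 4) * ((L : ℝ) ^ d * (L : ℝ) ^ 2) * a := by ring
    linarith
  exact exists_lift_periodic' hL hV hVP hw0 hwL hW φ hφ

end

end Summit.QuantumFields.BalabanUV.T4Continuum.AveragingDeficitLiftPeriodic
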